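import Mathlib
import Literature.AlgebraicGeometry.Resolution.WeightedResolutionDatum
import Literature.AlgebraicGeometry.Resolution.CobordantBlowupGlobal
import Summits.ResolutionOfSingularities.ResolutionOfSingularities.Theorems.WeightedInvariantDatumToEmbeddedCentreHomogeneous
import Summits.ResolutionOfSingularities.ResolutionOfSingularities.Theorems.WeightedInvariantWeightedConstructionCobordantBlowupRegular
import Summits.ResolutionOfSingularities.ResolutionOfSingularities.Theorems.WeightedInvariantDatumToEmbeddedExceptionalCharts
import HarnessLib

/-!
# A Veronese piece of the centre is a power of the exceptional ideal on `B₊`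

Topic: `Summits/ResolutionOfSingularities/ResolutionOfSingularities/Theorems`. Stub
`stub_qs_exceptional` of the line `Sketch` of the crux `Theses.WeightedInvariant.DatumToEmbedded`
(statement `stmt-ResolutionOfSingularities-0572`) of the summit
`Summit.ResolutionOfSingularities.ResolutionOfSingularities`.

Let `D` be a weighted resolution datum (`Literature/…/WeightedResolutionDatum.lean`),
`f : Y → Spec k` smooth separated quasi-compact over a perfect field of characteristic `p`, `I`
an ideal sheaf on `Y` with `inv` not everywhere minimal, and `R'` a Rees filtration on `Y` with
the pieces `Jₙ` of the centre `D.centre f I` — a regular weighted centre by axiom `(iii)`: every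
point of `Y` has an affine neighbourhood `U` with a weighted chart `Jₙ(U) = (u^α : Σ wᵢαᵢ ≥ n)`.
On the GLOBAL cobordant blow-up `σ₊ : B₊ = R'.plus → Y` of the tree
(`Literature/…/CobordantBlowupGlobal.lean`) Włodarczyk's Lemma 2.3.8 (arXiv:2203.03090:
"`𝒥 · 𝒪_{B₊} = t⁻¹ · 𝒪_{B₊}`") holds in the integral form consumed by the torus-quotient step of
the line: `J_D · 𝒪_{B₊} = (t⁻¹)^D` for every `D` divisible by `N₀`, the product of the weights of
finitely many weighted charts covering the quasi-compact `Y`.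

* `irrelevant_eq_map`, `map_mem_plusChart_iff`, `exists_mem_plusChart` — **`B₊ ∩ π⁻¹U` is the
  image of the vertex complement of the chart over `U`** for EVERY affine `U`: `B₊` is the union
  of these images, two charts of `B` meet in charts over common basic opens
  (`Scheme.IsLocallyDirected.ι_eq_ι_iff`), along which the irrelevant ideals `⊕_{n>0} Jₙ(·) tⁿ`
  extend to each other (`Scheme.IdealSheafData.map_ideal`);
* `comap_πPlus_eq_excPlus_pow` — ideal sheaves on `B₊` are compared on the open cover by the
  charts `Spec (⊕ Jₙ(U) tⁿ)[1/(uᵢ t^{wᵢ})]` over weighted charts `U` (companion file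
  `…DatumToEmbeddedExceptionalCharts.lean`: `exists_fac`, `exists_specMap_eq`, and
  `comap_comap_eq_comap_pow` — on such a chart both `σ₊^* J_D` and the `D`-th power of the
  exceptional ideal are the ideal sheaf of `((t⁻¹)^D)` once `wᵢ ∣ D`);
* `stub_qs_exceptional` — `Y` is quasi-compact (`QuasiCompact f` over the affine `Spec k`), so
  finitely many weighted charts cover it, and `N₀ := ∏ weights > 0`.

All proofs are glue on Mathlib and the tree; no definitions, no named facts.
-/

noncomputable section

open scoped LaurentPolynomial
open LaurentPolynomial CategoryTheory CategoryTheory.Limits AlgebraicGeometry TopologicalSpace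
open Literature.AlgebraicGeometry.Resolution
open Summit.ResolutionOfSingularities.ResolutionOfSingularities.Theorems

set_option linter.dupNamespace false -- mandated namespace `…Theorems.DatumToEmbedded.<Topic>`
-- `Γ(Y, U)` versus `Y.presheaf.obj (op U)` inside `rw` motives and instance problems on the glued
-- scheme `R'.cobordantBlowup` (as in `…DatumToEmbedded.InvDrop`):
set_option backward.isDefEq.respectTransparency false

namespace Summit.ResolutionOfSingularities.ResolutionOfSingularities.Theorems.DatumToEmbedded.Exceptional

universe u

/-! ## The global cobordant blow-up: `B₊` over a chart is the chart's vertex complement -/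

section Global

variable {Y : Scheme.{u}} (R' : ReesFiltration Y)

/-- Restriction of a monomial `a tⁿ` along `V ⊆ U`. [folklore] -/
theorem resL_C_mul_T {U V : Y.Opens} (hVU : V ≤ U) (a : Γ(Y, U)) (n : ℤ) :
    ReesFiltration.resL hVU (C a * T n) = C ((Y.presheaf.map (homOfLE hVU).op).hom a) * T n := by
  rw [map_mul, ReesFiltration.resL_C, ReesFiltration.resL_T]

/-- Along an arrow `V ⟶ U` of the small affine Zariski site (a basic open `V ⊆ U`), the irrelevant
ideal `⊕_{n>0} 𝒥ₙ(V) tⁿ` is the extension of `⊕_{n>0} 𝒥ₙ(U) tⁿ` under the restriction of the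
sections rings (`𝒥ₙ(V) = 𝒥ₙ(U) · Γ(Y, V)`, `Scheme.IdealSheafData.map_ideal`). [folklore] -/
theorem irrelevant_eq_map {V U : Y.AffineZariskiSite} (i : V ⟶ U) :
    (R'.filtration ⟨V.1, V.2⟩).irrelevant =
      ((R'.filtration ⟨U.1, U.2⟩).irrelevant).map (R'.diagram.map i.op).hom := by
  have hVU : (⟨V.1, V.2⟩ : Y.affineOpens) ≤ ⟨U.1, U.2⟩ :=
    Scheme.AffineZariskiSite.toOpens_mono i.le
  have hres : ∀ p : R'.sectionsRing ⟨U.1, U.2⟩,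
      ((R'.diagram.map i.op).hom p).val = ReesFiltration.resL hVU p.val := fun _ => rfl
  have hJ : ∀ n, ((R'.ideal n).ideal ⟨U.1, U.2⟩).map (Y.presheaf.map (homOfLE hVU).op).hom =
      (R'.ideal n).ideal ⟨V.1, V.2⟩ := fun n => (R'.ideal n).map_ideal hVU
  apply le_antisymm
  · rw [IdealFiltration.irrelevant, Ideal.span_le]
    rintro p ⟨n, a, hn, ha, hp⟩
    rw [SetLike.mem_coe]
    have ha' : a ∈ ((R'.ideal n).ideal ⟨U.1, U.2⟩).map (Y.presheaf.map (homOfLE hVU).op).hom := by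
      rw [hJ n]
      exact ha
    rw [Ideal.map] at ha'
    suffices key : ∀ a ∈ Ideal.span ((Y.presheaf.map (homOfLE hVU).op).hom ''
        ((R'.ideal n).ideal ⟨U.1, U.2⟩)), ∀ q : R'.sectionsRing ⟨V.1, V.2⟩,
        (q : (Γ(Y, V.1))[T;T⁻¹]) = C a * T (n : ℤ) →
          q ∈ ((R'.filtration ⟨U.1, U.2⟩).irrelevant).map (R'.diagram.map i.op).hom from
      key a ha' p hp
    intro a ha
    induction ha using Submodule.span_induction with
    | mem a hmem =>
      obtain ⟨b, hb, rfl⟩ := hmem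
      intro q hq
      have hb' : C b * T (n : ℤ) ∈ R'.sectionsRing ⟨U.1, U.2⟩ :=
        (R'.filtration ⟨U.1, U.2⟩).C_mul_T_mem_extendedRees_iff.mpr hb
      have e : q = (R'.diagram.map i.op).hom ⟨C b * T (n : ℤ), hb'⟩ :=
        Subtype.ext (hq.trans ((hres _).trans (resL_C_mul_T hVU b n)).symm)
      rw [e]
      exact Ideal.mem_map_of_mem _ (Ideal.subset_span ⟨n, b, hn, hb, rfl⟩)
    | zero =>
      intro q hq
      rw [map_zero, zero_mul] at hq
      rw [show q = 0 from Subtype.ext hq]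
      exact Ideal.zero_mem _
    | add a b ha hb iha ihb =>
      intro q hq
      have ha' : a ∈ (R'.filtration ⟨V.1, V.2⟩).ideal n := by
        rw [ReesFiltration.filtration_ideal, ← hJ n]
        exact ha
      have hb' : b ∈ (R'.filtration ⟨V.1, V.2⟩).ideal n := by
        rw [ReesFiltration.filtration_ideal, ← hJ n]
        exact hb
      have e : q = ⟨C a * T (n : ℤ), (R'.filtration _).C_mul_T_mem_extendedRees_iff.mpr ha'⟩ +
          ⟨C b * T (n : ℤ), (R'.filtration _).C_mul_T_mem_extendedRees_iff.mpr hb'⟩ :=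
        Subtype.ext (by rw [hq, AddMemClass.coe_add, map_add, add_mul])
      rw [e]
      exact Ideal.add_mem _ (iha _ rfl) (ihb _ rfl)
    | smul c a ha iha =>
      intro q hq
      have ha' : a ∈ (R'.filtration ⟨V.1, V.2⟩).ideal n := by
        rw [ReesFiltration.filtration_ideal, ← hJ n]
        exact ha
      have e : q = algebraMap _ (R'.sectionsRing ⟨V.1, V.2⟩) c *
          ⟨C a * T (n : ℤ), (R'.filtration _).C_mul_T_mem_extendedRees_iff.mpr ha'⟩ :=
        Subtype.ext (by
          rw [hq, MulMemClass.coe_mul, Subalgebra.coe_algebraMap, ← C_eq_algebraMap, smul_eq_mul,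
            map_mul, mul_assoc])
      rw [e]
      exact Ideal.mul_mem_left _ _ (iha _ rfl)
  · rw [Ideal.map_le_iff_le_comap, IdealFiltration.irrelevant, Ideal.span_le]
    rintro p ⟨n, b, hn, hb, hp⟩
    rw [SetLike.mem_coe, Ideal.mem_comap]
    refine Ideal.subset_span ⟨n, (Y.presheaf.map (homOfLE hVU).op).hom b, hn, ?_, ?_⟩
    · rw [ReesFiltration.filtration_ideal, ← hJ n]
      exact Ideal.mem_map_of_mem _ hb
    · exact (hres p).trans ((congrArg (ReesFiltration.resL hVU) hp).trans (resL_C_mul_T hVU b n))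

/-- **The vertex complements glue**: along the transition map of the charts of `B` over an arrow
`V ⟶ U` of the affine Zariski site, a point lies off `V(⊕_{n>0} 𝒥ₙ(U) tⁿ)` iff it lies off
`V(⊕_{n>0} 𝒥ₙ(V) tⁿ)`. [folklore] -/
theorem map_mem_plusChart_iff {V U : Y.AffineZariskiSite} (i : V ⟶ U)
    (x : Spec (CommRingCat.of (R'.sectionsRing ⟨V.1, V.2⟩))) :
    R'.glueData.functor.map i x ∈ R'.plusChart ⟨U.1, U.2⟩ ↔ x ∈ R'.plusChart ⟨V.1, V.2⟩ := by
  rw [R'.mem_plusChart_iff, R'.mem_plusChart_iff, irrelevant_eq_map R' i,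
    Ideal.map_le_iff_le_comap]
  exact Iff.rfl

/-- **`B₊ ∩ π⁻¹U` is the image of the chart's vertex complement**: a point of `B₊` over the
affine open `U` is the image of a point of `Spec ⊕ 𝒥ₙ(U) tⁿ` off `V(⊕_{n>0} 𝒥ₙ(U) tⁿ)` — `B₊`
is the union of these images over all affine opens, two charts meet in charts over common basic
opens (`Scheme.IsLocallyDirected.ι_eq_ι_iff`), and the vertex complements correspond
(`map_mem_plusChart_iff`). [cite: Wlodarczyk2022, Def. 5.1.1] -/
theorem exists_mem_plusChart (y' : R'.cobordantBlowup) (hy' : y' ∈ R'.plus)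
    (U : Y.affineOpens) (hU : R'.π y' ∈ (U : Y.Opens)) :
    ∃ q : Spec (CommRingCat.of (R'.sectionsRing U)), q ∈ R'.plusChart U ∧
      R'.openCover.f ⟨U.1, U.2⟩ q = y' := by
  have hy'U : y' ∈ (R'.openCover.f ⟨U.1, U.2⟩).opensRange := by
    rw [← R'.π_preimage ⟨U.1, U.2⟩]
    exact hU
  obtain ⟨q, rfl⟩ := hy'U
  obtain ⟨U', hU'⟩ := Opens.mem_iSup.mp hy'
  obtain ⟨q', hq', hqq'⟩ := hU'
  obtain ⟨k, fi, fj, x, rfl, rfl⟩ :=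
    (Scheme.IsLocallyDirected.ι_eq_ι_iff R'.glueData.functor).mp hqq'
  exact ⟨_, (map_mem_plusChart_iff R' fj x).mpr ((map_mem_plusChart_iff R' fi x).mp hq'), rfl⟩

/-- **`𝒥_D · 𝒪_{B₊} = (t⁻¹)^D` on the global cobordant blow-up** (Włodarczyk 2022, Lemma 2.3.8,
integral form): if `Y` is covered by affine opens `U j` carrying weighted presentations
`(u j, w j)` of the Rees filtration with all weights dividing `D`, then for every ideal sheaf `K`
with `K(U j) = 𝒥_D(U j)` the pull-back `σ₊^* K` to `B₊` is the `D`-th power of the exceptional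
ideal sheaf: ideal sheaves on `B₊` are compared on the open cover by the charts
`Spec (⊕ 𝒥ₙ(U j) tⁿ)[1/(uᵢ t^{wᵢ})]` (`exists_mem_plusChart`, `exists_specMap_eq`), on which
both are the ideal sheaf of `((t⁻¹)^D)` (`comap_comap_eq_comap_pow`).
[cite: Wlodarczyk2022, Lemma 2.3.8] -/
theorem comap_πPlus_eq_excPlus_pow {ι₀ : Type*} (U : ι₀ → Y.affineOpens)
    (hcov : ∀ y : Y, ∃ j, y ∈ (U j : Y.Opens)) {m : ι₀ → ℕ} (u : ∀ j, Fin (m j) → Γ(Y, U j))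
    (w : ∀ j, Fin (m j) → ℕ) (hw : ∀ j i, 0 < w j i)
    (h : ∀ j n, (R'.ideal n).ideal (U j) = Ideal.span (weightedMonomials (u j) (w j) n))
    (K : Y.IdealSheafData) {n : ℕ}
    (hK : ∀ j, K.ideal (U j) = Ideal.span (weightedMonomials (u j) (w j) n))
    (hn : ∀ j i, w j i ∣ n) :
    K.comap R'.πPlus = R'.excPlus ^ n := by
  -- the elements `uᵢ t^{wᵢ}` of the sections rings
  have hvmem : ∀ j i, C (u j i) * T (w j i : ℤ) ∈ R'.sectionsRing (U j) := fun j i =>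
    (R'.filtration (U j)).C_mul_T_mem_extendedRees_iff.mpr
      (by rw [ReesFiltration.filtration_ideal, h]; exact mem_weightedFiltration_ideal _ _ i)
  let v : ∀ j, Fin (m j) → R'.sectionsRing (U j) := fun j i => ⟨_, hvmem j i⟩
  have hv : ∀ j i, ((v j i : R'.sectionsRing (U j)) : (Γ(Y, U j))[T;T⁻¹]) =
      C (u j i) * T (w j i : ℤ) := fun _ _ => rfl
  -- the charts `ψ j i : Spec (⊕ 𝒥ₙ(U j) tⁿ)[1/(uᵢ t^{wᵢ})] ⟶ B₊`
  have hO : ∀ j x, x ∈ R'.plusChart (U j) → R'.openCover.f ⟨(U j).1, (U j).2⟩ x ∈ R'.plus :=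
    fun j x hx => R'.image_plusChart_le_plus ⟨(U j).1, (U j).2⟩ ⟨x, hx, rfl⟩
  have hex := fun j i => exists_fac R'.plus R' (U j) (R'.openCover.f ⟨(U j).1, (U j).2⟩) (hO j)
    (u j) (w j) (hw j) (h j) (v j) (hv j) (fun i => Localization.Away (v j i)) i
  choose ψ hψ using hex
  have hψo : ∀ j i, IsOpenImmersion (ψ j i) := fun j i =>
    isOpenImmersion_of_fac R'.plus R' (U j) (R'.openCover.f _) (v j)
      (fun i => Localization.Away (v j i)) (ψ j i) (hψ j i)
  -- they cover `B₊`
  have hcovers : ∀ y' : (R'.plus : Scheme.{u}), ∃ (ji : Σ j, Fin (m j))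
      (x : Spec (CommRingCat.of (Localization.Away (v ji.1 ji.2)))), ψ ji.1 ji.2 x = y' := by
    intro y'
    obtain ⟨j, hj⟩ := hcov (R'.π y'.1)
    obtain ⟨q, hq, hqy⟩ := exists_mem_plusChart R' y'.1 y'.2 (U j) hj
    obtain ⟨i, x, rfl⟩ := exists_specMap_eq R' (U j) (u j) (w j) (h j) (v j) (hv j)
      (fun i => Localization.Away (v j i)) q hq
    refine ⟨⟨j, i⟩, x, R'.plus.ι.injective ?_⟩
    rw [← Scheme.Hom.comp_apply, hψ, Scheme.Hom.comp_apply, Scheme.Opens.ι_apply]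
    exact hqy
  exact CentreHomogeneous.idealSheaf_ext_of_openCover
    (Scheme.Cover.mkOfCovers (Σ j, Fin (m j)) _ (fun ji => ψ ji.1 ji.2) hcovers
      (fun ji => hψo ji.1 ji.2))
    fun ji => comap_comap_eq_comap_pow R'.π R'.toA1 R'.plus R' (U ji.1) (R'.openCover.f _)
      (R'.ι_π _) (R'.ι_toA1 _) (u ji.1) (w ji.1) (v ji.1) (hv ji.1)
      (fun i => Localization.Away (v ji.1 i)) (ψ ji.1 ji.2) (hψ ji.1 ji.2) K (hK ji.1)
      (hn ji.1 ji.2)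

end Global

/-! ## The stub -/

/-- **STUB `stub_qs_exceptional`** of the line `Sketch` of crux `DatumToEmbedded`: **on `B₊` a
Veronese piece of the centre is a power of the exceptional ideal.** For a weighted resolution
datum `D`, `f : Y → Spec k` smooth separated quasi-compact over a perfect field, an ideal sheaf `I`
with `inv` not everywhere minimal and a Rees filtration `R'` with the pieces of the centre
`D.centre f I` (a regular weighted centre, axiom `(iii)`), there is `N₀ > 0` — the product of the
weights of finitely many weighted charts covering the quasi-compact `Y` — such that for every
multiple `Dg` of `N₀`, `J_Dg · 𝒪_{B₊} = (t⁻¹)^Dg` on the global cobordant blow-up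
`B₊ = R'.plus → Y` (Włodarczyk 2022, Lemma 2.3.8: "`𝒥 · 𝒪_{B₊} = t⁻¹ · 𝒪_{B₊}`"; on the chart
`D(uᵢ t^{wᵢ})` over a weighted chart, `u^α = (t⁻¹)^{Σ αw} ∏ (uⱼ t^{wⱼ})^{αⱼ}` and
`(t⁻¹)^{wᵢ} = uᵢ (uᵢ t^{wᵢ})⁻¹`). [cite: Wlodarczyk2022, Lemma 2.3.8] -/
theorem stub_qs_exceptional :
    ∀ {p : ℕ} (D : WeightedResolutionDatum p) {k : Type} [Field k] [CharP k p] [PerfectField k]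
      {Y : Scheme.{0}} (f : Y ⟶ Spec (.of k)) [Smooth f] [IsSeparated f] [QuasiCompact f]
      (I : Y.IdealSheafData), (∃ y : Y, ¬ IsBot (D.inv f I y)) →
      ∀ (R' : ReesFiltration Y), R'.ideal = (D.centre f I).piece →
      ∃ N₀ : ℕ, 0 < N₀ ∧ ∀ Dg : ℕ, N₀ ∣ Dg →
        ((D.centre f I).piece Dg).comap R'.πPlus = R'.excPlus ^ Dg := by
  intro p D k _ _ _ Y f _ _ _ I hguard R' hR'
  -- finitely many weighted charts of the regular weighted centre cover the quasi-compact `Y`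
  choose U hyU m u w hchart using D.isRegularWeightedCentre_centre f I hguard
  haveI : CompactSpace Y := QuasiCompact.compactSpace_of_compactSpace f
  obtain ⟨t, ht⟩ : ∃ t : Finset Y, ∀ y : Y, ∃ y₀ ∈ t, y ∈ (U y₀ : Y.Opens) := by
    obtain ⟨t, ht⟩ := isCompact_univ.elim_finite_subcover (fun y₀ : Y => ((U y₀ : Y.Opens) : Set Y))
      (fun y₀ => (U y₀ : Y.Opens).2) (fun y _ => Set.mem_iUnion.mpr ⟨y, hyU y⟩)
    refine ⟨t, fun y => ?_⟩
    simpa only [Set.mem_iUnion, exists_prop, SetLike.mem_coe] using ht (Set.mem_univ y)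
  refine ⟨∏ y₀ ∈ t, ∏ i, w y₀ i,
    Finset.prod_pos fun y₀ _ => Finset.prod_pos fun i _ => (hchart y₀).w_pos i, fun Dg hDg => ?_⟩
  have hmon : ∀ (y₀ : Y) (n : ℕ), (R'.ideal n).ideal (U y₀) =
      Ideal.span (weightedMonomials (u y₀) (w y₀) n) := fun y₀ n => by
    rw [hR', (hchart y₀).ideal_eq n, weightedMonomialIdeal_eq_span_weightedMonomials]
  exact comap_πPlus_eq_excPlus_pow R' (fun y₀ : t => U y₀)
    (fun y => let ⟨y₀, hy₀, hy⟩ := ht y; ⟨⟨y₀, hy₀⟩, hy⟩) (fun y₀ => u y₀) (fun y₀ => w y₀)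
    (fun y₀ => (hchart y₀).w_pos) (fun y₀ => hmon y₀) ((D.centre f I).piece Dg)
    (fun y₀ => by rw [(hchart _).ideal_eq Dg, weightedMonomialIdeal_eq_span_weightedMonomials])
    fun y₀ i => ((Finset.dvd_prod_of_mem (w y₀) (Finset.mem_univ i)).trans
      (Finset.dvd_prod_of_mem (fun y₁ => ∏ i, w y₁ i) y₀.2)).trans hDg

end Summit.ResolutionOfSingularities.ResolutionOfSingularities.Theorems.DatumToEmbedded.Exceptional

end
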